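import Summits.NavierStokesRegularity.NavierStokesRegularity.Theses.SqueezeCycle
import Summits.NavierStokesRegularity.NavierStokesRegularity.Theorems.SqueezeCycleExtremalBiaxialitySubcriticalOfLiouville
import Summits.NavierStokesRegularity.NavierStokesRegularity.Theorems.SqueezeCycleExtremalBiaxialitySubcriticalReductions
import Summits.NavierStokesRegularity.NavierStokesRegularity.Theorems.SqueezeCycleExtremalBiaxialitySubcriticalExtremal
import Summits.NavierStokesRegularity.NavierStokesRegularity.Theorems.SqueezeCycleStrainAlgebra
import Summits.NavierStokesRegularity.NavierStokesRegularity.Theorems.SqueezeCycleExtremalBiaxialitySubcriticalGaugeStrainBound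
import Summits.NavierStokesRegularity.NavierStokesRegularity.Theorems.SqueezeCycleExtremalBiaxialitySubcriticalCubicProductionBound
import Literature.Analysis.FluidPDE.TypeIAncientMild
import Literature.Analysis.FluidPDE.LerayGaugeStrainSpectrum
import HarnessLib

/-!
# Route `SqueezeCycle`, crux `ExtremalBiaxialitySubcritical` — the quarter bootstrap with the cubic margin (line `quarter-bootstrap-pinning`)

Helper file for item `stmt-NavierStokesRegularity-11609`
(`Summit.NavierStokesRegularity.NavierStokesRegularity.Theses.SqueezeCycle.ExtremalBiaxialitySubcritical`):
the COMPOSITION of line `quarter-bootstrap-pinning` as a sorry-free typed reduction. Of the line's four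
registered stubs, two are theorems — the class-uniform Leray-gauge strain bound `|𝔖| ≤ K(C)`
(`stub_gaugeStrainBound`, KNSS 2009 (4.6) with `k = 1` on the class, p72389) and the cubic production
ceiling `−4 det S ≤ (2m − 4m³/K²)|S|²` under `λ₂ ≤ m`, `|S| ≤ K` (`stub_cubicProductionBound`, p72572) —
and two are open; this file proves

  `stub_leakyQuarterLawCeiling → stub_largeExcessExclusion → ExtremalBiaxialitySubcritical`

with the two open statements as displayed hypotheses (their registered signatures, with the route's
inline class written as the tree's `IsTypeIAncientMild C ·` plus the scaled-energy clause —
`isTypeIAncientMild_iff`, definitional):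

* the **leaky quarter law in production-ceiling currency** (for `b < ¼`, an element of `𝒦_C` with
  `−4 det S ≤ (2b/(−t))|S|²_F` pointwise vanishes) — the engine of the sibling crux `MustSqueeze`
  (stmt-NavierStokesRegularity-11610) at every threshold below `¼`;
* the **large-excess exclusion** (no extremal configuration with `¼ ≤ m − 2m³/K²`) — the crux itself on
  the regime the bootstrap cannot reach.

Conversely the crux implies the large-excess exclusion trivially
(`largeExcessExclusion_of_extremalBiaxialitySubcritical`, registered signature verbatim, and its
tree-class twin), so modulo the leaky quarter law the open stub is EQUIVALENT to the crux — it is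
crux-sized, not a lemma. So, relative to `extremalBiaxialitySubcritical_bootstrap` (p70115: crux ⇐ MustSqueeze family ∧ "no
attained maximum `m ≥ ¼`"), the strain bound and the exact cubic identity buy the `C`-dependent margin
`2m³/K(C)²`: the bootstrap reaches every attained maximum with `m − 2m³/K² < ¼`. Proof: maximality is a
ceiling `Λ ≤ m` on the whole class, in particular on `u`; with `|𝔖| ≤ K` and `6m² ≤ |𝔖(t₀,x₀)|² ≤ K²`
(attainment) the cubic ceiling turns it into the production ceiling at `b = m − 2m³/K²`; if `b < ¼` the
leaky quarter law kills `u` and attainment forces `m ≤ 0 < 1/8`; if `b ≥ ¼` the large-excess exclusion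
applies.
-/

noncomputable section

open MeasureTheory Set Filter Topology
open scoped RealInnerProductSpace Matrix

namespace Summit.NavierStokesRegularity.NavierStokesRegularity.Theorems

open Literature.Analysis.FluidPDE
open Summit.NavierStokesRegularity.NavierStokesRegularity.Theses.SqueezeCycle

/-- **The quarter bootstrap with the cubic margin** (line `quarter-bootstrap-pinning`, composition):
the crux `ExtremalBiaxialitySubcritical` follows from (i) the leaky quarter law in production-ceiling
currency for every `b < ¼` and (ii) the exclusion of extremal configurations with `¼ ≤ m − 2m³/K²`, the
class-uniform gauge strain bound (`stub_gaugeStrainBound`) and the cubic production ceiling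
(`stub_cubicProductionBound`) being theorems. Take `K = K(C)`; `m ≥ 0` by `nonneg_of_maximal`; if
`¼ ≤ m − 2m³/K²` use (ii) (with the ceiling `Λ ≤ m` and attainment `m ≤ Λ_u(t₀,x₀)` in
`lerayMiddleStrain` form, `extremal_lerayMiddleStrain_eq`); otherwise `6m² ≤ K²`
(`six_mul_midStrain_sq_le` at the attainment point), the cubic ceiling at `(m/(−t), K/(−t))` gives
`−4 det S ≤ (2b/(−t))|S|²` for `u` at every point, (i) gives `u ≡ 0`, and the attainment clause on the
zero slice gives `m ≤ 0 < 1/8` (`nonpos_of_twoFrame_lower_of_slice_zero`). [folklore] -/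
theorem extremalBiaxialitySubcritical_of_leakyQuarterLaw_of_largeExcessExclusion :
    (∀ (C b : ℝ), b < 1 / 4 → ∀ (u : ℝ → EuclideanSpace ℝ (Fin 3) → EuclideanSpace ℝ (Fin 3)), Literature.Analysis.FluidPDE.IsTypeIAncientMild C u → (∀ (x₀ : EuclideanSpace ℝ (Fin 3)) (t₀ r : ℝ), t₀ ≤ 0 → 0 < r → (∀ t, t₀ - r^2 < t → t < t₀ → r⁻¹ * ∫ x in Metric.ball x₀ r, ‖u t x‖^2 ≤ C) ∧ r⁻¹ * ∫ t in Set.Ioo (t₀ - r^2) t₀, ∫ x in Metric.ball x₀ r, ‖fderiv ℝ (u t) x‖^2 ≤ C) → (∀ t < 0, ∀ x, -4 * (((1 / 2 : ℝ) • (Literature.Analysis.FluidPDE.stdMatrix (fderiv ℝ (u t) x : EuclideanSpace ℝ (Fin 3) →ₗ[ℝ] EuclideanSpace ℝ (Fin 3)) + (Literature.Analysis.FluidPDE.stdMatrix (fderiv ℝ (u t) x : EuclideanSpace ℝ (Fin 3) →ₗ[ℝ] EuclideanSpace ℝ (Fin 3)))ᵀ))).det ≤ (2 * b / (-t)) * (∑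 i, ∑ j, (((1 / 2 : ℝ) • (Literature.Analysis.FluidPDE.stdMatrix (fderiv ℝ (u t) x : EuclideanSpace ℝ (Fin 3) →ₗ[ℝ] EuclideanSpace ℝ (Fin 3)) + (Literature.Analysis.FluidPDE.stdMatrix (fderiv ℝ (u t) x : EuclideanSpace ℝ (Fin 3) →ₗ[ℝ] EuclideanSpace ℝ (Fin 3)))ᵀ)) i j) ^ 2)) → ∀ t < 0, ∀ x, u t x = 0) → (∀ (C K m : ℝ) (u : ℝ → EuclideanSpace ℝ (Fin 3) → EuclideanSpace ℝ (Fin 3)) (t₀ : ℝ) (x₀ : EuclideanSpace ℝ (Fin 3)), 0 < K → (∀ (v' : ℝ → EuclideanSpace ℝ (Fin 3) → EuclideanSpace ℝ (Fin 3)), Literature.Analysis.FluidPDE.IsTypeIAncientMild C v' → (∀ (x₀ : EuclideanSpace ℝ (Fin 3)) (t₀ r : ℝ), t₀ ≤ 0 → 0 < r → (∀ t, t₀ - r^2 < t → t < t₀ → r⁻¹ * ∫ x in Metric.ball x₀ r, ‖v' t x‖^2 ≤ C) ∧ r⁻¹ * ∫ t in Set.Ioo (t₀ - r^2) t₀, ∫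 x in Metric.ball x₀ r, ‖fderiv ℝ (v' t) x‖^2 ≤ C) → ∀ t < 0, ∀ x, (∑ i, ∑ j, (((1 / 2 : ℝ) • (Literature.Analysis.FluidPDE.stdMatrix (fderiv ℝ (v' t) x : EuclideanSpace ℝ (Fin 3) →ₗ[ℝ] EuclideanSpace ℝ (Fin 3)) + (Literature.Analysis.FluidPDE.stdMatrix (fderiv ℝ (v' t) x : EuclideanSpace ℝ (Fin 3) →ₗ[ℝ] EuclideanSpace ℝ (Fin 3)))ᵀ)) i j) ^ 2) ≤ (K / (-t)) ^ 2 ∧ Literature.Analysis.FluidPDE.lerayMiddleStrain v' t x ≤ m) → 0 ≤ m → 1 / 4 ≤ m - 2 * m ^ 3 / K ^ 2 → t₀ < 0 → Literature.Analysis.FluidPDE.IsTypeIAncientMild C u → (∀ (x₀ : EuclideanSpace ℝ (Fin 3)) (t₀ r : ℝ), t₀ ≤ 0 → 0 < r → (∀ t, t₀ - r^2 < t → t < t₀ → r⁻¹ * ∫ x in Metric.ball x₀ r, ‖u t x‖^2 ≤ C) ∧ r⁻¹ * ∫ t in Set.Ioo (t₀ - r^2) t₀, ∫ x in Metric.ball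 x₀ r, ‖fderiv ℝ (u t) x‖^2 ≤ C) → m ≤ Literature.Analysis.FluidPDE.lerayMiddleStrain u t₀ x₀ → False) → Summit.NavierStokesRegularity.NavierStokesRegularity.Theses.SqueezeCycle.ExtremalBiaxialitySubcritical := by
  intro hLQ hLE C m u t₀ x₀ ht₀ hu hGE hmax
  -- the class-uniform gauge strain bound (landed stub)
  obtain ⟨K, hK, hKb⟩ := stub_gaugeStrainBound C
  -- calibration: `C ≥ 0`, `m ≥ 0`
  have hC : 0 ≤ C := squeezeClass_constant_nonneg hu.2.2.2.1
  have hm0 : 0 ≤ m := nonneg_of_maximal hC hmax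
  -- the two clauses in `lerayMiddleStrain` form
  obtain ⟨hΛeq, hΛle⟩ := extremal_lerayMiddleStrain_eq ht₀ hu hGE hmax
  obtain ⟨h1, h2, h3, h4, h5⟩ := hu
  have hKu : IsTypeIAncientMild C u := isTypeIAncientMild_of_squeezeClass h1 h2 h3 h4
  by_cases hreg : 1 / 4 ≤ m - 2 * m ^ 3 / K ^ 2
  · -- ## large excess: the open exclusion
    refine (hLE C K m u t₀ x₀ hK (fun v' hv' hve t ht x => ?_) hm0 hreg ht₀ hKu h5 hΛeq.ge).elim
    -- unfold the tree class of `v'` to the route's inline clauses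
    obtain ⟨a1, a2, a3, a4⟩ := isTypeIAncientMild_iff.1 hv'
    have a3' : ∀ s t : ℝ, s < t → t < 0 → ∀ x, v' t x = Literature.Analysis.FluidPDE.heatFlow (v' s) (t-s) x - ∫ τ in Set.Ioo s t, ∫ y, ((-(inner ℝ (x-y) (v' τ y) / (2*(t-τ)) * Literature.Analysis.UnboundedOperators.heatKernel (t-τ) (x-y))) • v' τ y + (∫ σ in Set.Ioi (t-τ), Literature.Analysis.UnboundedOperators.heatKernel σ (x-y) / (4*σ^2)) • (inner ℝ (x-y) (v' τ y) • v' τ y + inner ℝ (v' τ y) (v' τ y) • (x-y) + inner ℝ (x-y) (v' τ y) • v' τ y) - ((∫ σ in Set.Ioi (t-τ), Literature.Analysis.UnboundedOperators.heatKernel σ (x-y) / (8*σ^3)) * (inner ℝ (x-y) (v' τ y) * inner ℝ (x-y) (v' τ y))) • (x-y)) := by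
      intro s t hst ht x
      rw [a3 s t hst ht x]
      rfl
    exact ⟨hKb v' ⟨a1, a2, a3', a4, hve⟩ t ht x, hΛle v' ⟨a1, a2, a3', a4, hve⟩ t ht x⟩
  · -- ## small excess: bootstrap through the production ceiling
    replace hreg : m - 2 * m ^ 3 / K ^ 2 < 1 / 4 := not_le.1 hreg
    set b : ℝ := m - 2 * m ^ 3 / K ^ 2 with hb
    -- trace-free velocity gradients
    have htr : ∀ t < 0, ∀ x, (stdMatrix (fderiv ℝ (u t) x : EuclideanSpace ℝ (Fin 3) →ₗ[ℝ] EuclideanSpace ℝ (Fin 3))).trace = 0 := by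
      intro t ht x
      rw [trace_stdMatrix]
      exact h2 t ht x
    -- `6 m² ≤ K²` from the attained value
    have h6 : 6 * m ^ 2 ≤ K ^ 2 := by
      set M := stdMatrix (fderiv ℝ (u t₀) x₀ : EuclideanSpace ℝ (Fin 3) →ₗ[ℝ] EuclideanSpace ℝ (Fin 3)) with hM
      have hsix := six_mul_midStrain_sq_le M (htr t₀ ht₀ x₀)
      have hS := hKb u ⟨h1, h2, h3, h4, h5⟩ t₀ ht₀ x₀
      have hΛ : lerayMiddleStrain u t₀ x₀ =
          (-t₀) * (2⁻¹ * (Matrix.isHermitian_add_transpose_self M).eigenvalues₀ 1) :=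
        lerayMiddleStrain_eq_eigenvalues₀
      rw [hΛeq] at hΛ
      have hKt : ((K / (-t₀)) ^ 2) * (-t₀) ^ 2 = K ^ 2 := by
        have ht0 : t₀ ≠ 0 := ht₀.ne
        field_simp
      set σ := ∑ i, ∑ j, (((1 / 2 : ℝ) • (M + Mᵀ)) i j) ^ 2 with hσ
      set μ := (Matrix.isHermitian_add_transpose_self M).eigenvalues₀ 1 with hμ
      have hσK : σ * (-t₀) ^ 2 ≤ K ^ 2 := by
        rw [← hKt]
        exact mul_le_mul_of_nonneg_right hS (sq_nonneg _)
      calc 6 * m ^ 2 = (3 / 2 * μ ^ 2) * (-t₀) ^ 2 := by rw [hΛ]; ring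
        _ ≤ σ * (-t₀) ^ 2 := mul_le_mul_of_nonneg_right hsix (sq_nonneg _)
        _ ≤ K ^ 2 := hσK
    -- the production ceiling at every point of `u`
    have hceil : ∀ t < 0, ∀ x,
        -4 * (((1 / 2 : ℝ) • (Literature.Analysis.FluidPDE.stdMatrix (fderiv ℝ (u t) x : EuclideanSpace ℝ (Fin 3) →ₗ[ℝ] EuclideanSpace ℝ (Fin 3)) + (Literature.Analysis.FluidPDE.stdMatrix (fderiv ℝ (u t) x : EuclideanSpace ℝ (Fin 3) →ₗ[ℝ] EuclideanSpace ℝ (Fin 3)))ᵀ))).det ≤ (2 * b / (-t)) * (∑ i, ∑ j, (((1 / 2 : ℝ) • (Literature.Analysis.FluidPDE.stdMatrix (fderiv ℝ (u t) x : EuclideanSpace ℝ (Fin 3) →ₗ[ℝ] EuclideanSpace ℝ (Fin 3)) + (Literature.Analysis.FluidPDE.stdMatrix (fderiv ℝ (u t) x : EuclideanSpace ℝ (Fin 3) →ₗ[ℝ] EuclideanSpace ℝ (Fin 3)))ᵀ)) i j) ^ 2) := by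
      intro t ht x
      have ht' : 0 < -t := neg_pos.2 ht
      set M := stdMatrix (fderiv ℝ (u t) x : EuclideanSpace ℝ (Fin 3) →ₗ[ℝ] EuclideanSpace ℝ (Fin 3)) with hM
      have hΛle_u : lerayMiddleStrain u t x ≤ m := hΛle u ⟨h1, h2, h3, h4, h5⟩ t ht x
      have hΛ : lerayMiddleStrain u t x =
          (-t) * (2⁻¹ * (Matrix.isHermitian_add_transpose_self M).eigenvalues₀ 1) :=
        lerayMiddleStrain_eq_eigenvalues₀
      have hμ : (Matrix.isHermitian_add_transpose_self M).eigenvalues₀ 1 ≤ 2 * (m / (-t)) := by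
        rw [hΛ] at hΛle_u
        rw [mul_div_assoc', le_div_iff₀ ht']
        nlinarith
      have hmK : 6 * (m / (-t)) ^ 2 ≤ (K / (-t)) ^ 2 := by
        rw [div_pow, div_pow]
        exact (by
          rw [← mul_div_assoc]
          exact div_le_div_of_nonneg_right h6 (sq_nonneg _) :
            6 * (m ^ 2 / (-t) ^ 2) ≤ K ^ 2 / (-t) ^ 2)
      have hcub := stub_cubicProductionBound M (m / (-t)) (K / (-t)) (htr t ht x)
        (div_nonneg hm0 ht'.le) (div_pos hK ht') hmK hμ (hKb u ⟨h1, h2, h3, h4, h5⟩ t ht x)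
      have hcoef : 2 * (m / (-t)) - 4 * (m / (-t)) ^ 3 / (K / (-t)) ^ 2 = 2 * b / (-t) := by
        rw [hb]
        field_simp
        ring
      rw [hcoef] at hcub
      exact hcub
    -- the leaky quarter law kills `u`
    have hz : ∀ t < 0, ∀ x, u t x = 0 := hLQ C b hreg u hKu h5 hceil
    have hm : m ≤ 0 := nonpos_of_twoFrame_lower_of_slice_zero (hz t₀ ht₀) hGE
    linarith

/-! ### The open stub is crux-sized: the converse reductions -/

/-- **The crux implies the large-excess exclusion** (registered signature of
`stub_largeExcessExclusion`, verbatim): an extremal configuration with `¼ ≤ m − 2m³/K²` has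
`m ≥ ¼ > 1/8` (as `m ≥ 0`), while the crux gives `m < 1/8` (the `lerayMiddleStrain` clauses are the
two-frame clauses, `le_lerayMiddleStrain_iff` / `lerayMiddleStrain_le_iff`). So, modulo the leaky
quarter law, the open stub of line quarter-bootstrap-pinning is EQUIVALENT to the crux. [folklore] -/
theorem largeExcessExclusion_of_extremalBiaxialitySubcritical
    (hX : Summit.NavierStokesRegularity.NavierStokesRegularity.Theses.SqueezeCycle.ExtremalBiaxialitySubcritical) :
    ∀ (C K m : ℝ) (u : ℝ → EuclideanSpace ℝ (Fin 3) → EuclideanSpace ℝ (Fin 3)) (t₀ : ℝ) (x₀ : EuclideanSpace ℝ (Fin 3)), 0 < K → (∀ (v' : ℝ → EuclideanSpace ℝ (Fin 3) → EuclideanSpace ℝ (Fin 3)), ContDiffOn ℝ (⊤ : ℕ∞) (Function.uncurry v') (Set.Iio 0 ×ˢ Set.univ) ∧ (∀ t < 0, Literature.Analysis.FluidPDE.VectorCalculus.IsDivFree (v' t)) ∧ (∀ s t : ℝ, s < t → t < 0 → ∀ x, v' t x = Literature.Analysis.FluidPDE.heatFlow (v' s) (t-s) x - ∫ τ in Set.Ioo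 s t, ∫ y, ((-(inner ℝ (x-y) (v' τ y) / (2*(t-τ)) * Literature.Analysis.UnboundedOperators.heatKernel (t-τ) (x-y))) • v' τ y + (∫ σ in Set.Ioi (t-τ), Literature.Analysis.UnboundedOperators.heatKernel σ (x-y) / (4*σ^2)) • (inner ℝ (x-y) (v' τ y) • v' τ y + inner ℝ (v' τ y) (v' τ y) • (x-y) + inner ℝ (x-y) (v' τ y) • v' τ y) - ((∫ σ in Set.Ioi (t-τ), Literature.Analysis.UnboundedOperators.heatKernel σ (x-y) / (8*σ^3)) * (inner ℝ (x-y) (v' τ y) * inner ℝ (x-y) (v' τ y))) • (x-y))) ∧ Literature.Analysis.FluidPDE.HasTypeITimeDecay C v' ∧ (∀ (x₀ : EuclideanSpace ℝ (Fin 3)) (t₀ r : ℝ), t₀ ≤ 0 → 0 < r → (∀ t, t₀ - r^2 < t → t < t₀ → r⁻¹ * ∫ x in Metric.ball x₀ r, ‖v' t x‖^2 ≤ C) ∧ r⁻¹ * ∫ t in Set.Ioo (t₀ - r^2) t₀, ∫ x in Metric.ball x₀ r, ‖fderiv ℝ (v' t) x‖^2 ≤ C) → ∀ t < 0, ∀ x,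 (∑ i, ∑ j, (((1 / 2 : ℝ) • (Literature.Analysis.FluidPDE.stdMatrix (fderiv ℝ (v' t) x : EuclideanSpace ℝ (Fin 3) →ₗ[ℝ] EuclideanSpace ℝ (Fin 3)) + (Literature.Analysis.FluidPDE.stdMatrix (fderiv ℝ (v' t) x : EuclideanSpace ℝ (Fin 3) →ₗ[ℝ] EuclideanSpace ℝ (Fin 3)))ᵀ)) i j) ^ 2) ≤ (K / (-t)) ^ 2 ∧ Literature.Analysis.FluidPDE.lerayMiddleStrain v' t x ≤ m) → 0 ≤ m → 1 / 4 ≤ m - 2 * m ^ 3 / K ^ 2 → t₀ < 0 → (ContDiffOn ℝ (⊤ : ℕ∞) (Function.uncurry u) (Set.Iio 0 ×ˢ Set.univ) ∧ (∀ t < 0, Literature.Analysis.FluidPDE.VectorCalculus.IsDivFree (u t)) ∧ (∀ s t : ℝ, s < t → t < 0 → ∀ x, u t x = Literature.Analysis.FluidPDE.heatFlow (u s) (t-s) x - ∫ τ in Set.Ioo s t, ∫ y, ((-(inner ℝ (x-y) (u τ y) / (2*(t-τ)) * Literature.Analysis.UnboundedOperators.heatKernel (t-τ) (x-y))) • u τ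 y + (∫ σ in Set.Ioi (t-τ), Literature.Analysis.UnboundedOperators.heatKernel σ (x-y) / (4*σ^2)) • (inner ℝ (x-y) (u τ y) • u τ y + inner ℝ (u τ y) (u τ y) • (x-y) + inner ℝ (x-y) (u τ y) • u τ y) - ((∫ σ in Set.Ioi (t-τ), Literature.Analysis.UnboundedOperators.heatKernel σ (x-y) / (8*σ^3)) * (inner ℝ (x-y) (u τ y) * inner ℝ (x-y) (u τ y))) • (x-y))) ∧ Literature.Analysis.FluidPDE.HasTypeITimeDecay C u ∧ (∀ (x₀ : EuclideanSpace ℝ (Fin 3)) (t₀ r : ℝ), t₀ ≤ 0 → 0 < r → (∀ t, t₀ - r^2 < t → t < t₀ → r⁻¹ * ∫ x in Metric.ball x₀ r, ‖u t x‖^2 ≤ C) ∧ r⁻¹ * ∫ t in Set.Ioo (t₀ - r^2) t₀, ∫ x in Metric.ball x₀ r, ‖fderiv ℝ (u t) x‖^2 ≤ C)) → m ≤ Literature.Analysis.FluidPDE.lerayMiddleStrain u t₀ x₀ → False := by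
  intro C K m u t₀ x₀ hK hbd hm0 hreg ht₀ hu hΛ
  have hK2 : 0 < K ^ 2 := by positivity
  have hm4 : 1 / 4 ≤ m := by
    have h : 0 ≤ 2 * m ^ 3 / K ^ 2 := by positivity
    linarith
  have hGE := (le_lerayMiddleStrain_iff ht₀ m).1 hΛ
  have hlt : m < 1 / 8 := hX C m u t₀ x₀ ht₀ hu hGE
    (fun v' hv' t ht x => (lerayMiddleStrain_le_iff ht m).1 (hbd v' hv' t ht x).2)
  linarith

/-- **The crux implies the large-excess exclusion**, tree-class form (the hypothesis of
`extremalBiaxialitySubcritical_of_leakyQuarterLaw_of_largeExcessExclusion`): same argument, with the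
route's inline class unfolded from / folded into `IsTypeIAncientMild` (`isTypeIAncientMild_iff`,
`isTypeIAncientMild_of_squeezeClass`). [folklore] -/
theorem largeExcessExclusion'_of_extremalBiaxialitySubcritical
    (hX : Summit.NavierStokesRegularity.NavierStokesRegularity.Theses.SqueezeCycle.ExtremalBiaxialitySubcritical) :
    ∀ (C K m : ℝ) (u : ℝ → EuclideanSpace ℝ (Fin 3) → EuclideanSpace ℝ (Fin 3)) (t₀ : ℝ) (x₀ : EuclideanSpace ℝ (Fin 3)), 0 < K → (∀ (v' : ℝ → EuclideanSpace ℝ (Fin 3) → EuclideanSpace ℝ (Fin 3)), Literature.Analysis.FluidPDE.IsTypeIAncientMild C v' → (∀ (x₀ : EuclideanSpace ℝ (Fin 3)) (t₀ r : ℝ), t₀ ≤ 0 → 0 < r → (∀ t, t₀ - r^2 < t → t < t₀ → r⁻¹ * ∫ x in Metric.ball x₀ r, ‖v' t x‖^2 ≤ C) ∧ r⁻¹ * ∫ t in Set.Ioo (t₀ - r^2) t₀, ∫ x in Metric.ball x₀ r, ‖fderiv ℝ (v' t) x‖^2 ≤ C) → ∀ t < 0, ∀ x, (∑ i, ∑ j,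 (((1 / 2 : ℝ) • (Literature.Analysis.FluidPDE.stdMatrix (fderiv ℝ (v' t) x : EuclideanSpace ℝ (Fin 3) →ₗ[ℝ] EuclideanSpace ℝ (Fin 3)) + (Literature.Analysis.FluidPDE.stdMatrix (fderiv ℝ (v' t) x : EuclideanSpace ℝ (Fin 3) →ₗ[ℝ] EuclideanSpace ℝ (Fin 3)))ᵀ)) i j) ^ 2) ≤ (K / (-t)) ^ 2 ∧ Literature.Analysis.FluidPDE.lerayMiddleStrain v' t x ≤ m) → 0 ≤ m → 1 / 4 ≤ m - 2 * m ^ 3 / K ^ 2 → t₀ < 0 → Literature.Analysis.FluidPDE.IsTypeIAncientMild C u → (∀ (x₀ : EuclideanSpace ℝ (Fin 3)) (t₀ r : ℝ), t₀ ≤ 0 → 0 < r → (∀ t, t₀ - r^2 < t → t < t₀ → r⁻¹ * ∫ x in Metric.ball x₀ r, ‖u t x‖^2 ≤ C) ∧ r⁻¹ * ∫ t in Set.Ioo (t₀ - r^2) t₀, ∫ x in Metric.ball x₀ r, ‖fderiv ℝ (u t) x‖^2 ≤ C) → m ≤ Literature.Analysis.FluidPDE.lerayMiddleStrain u t₀ x₀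 → False := by
  intro C K m u t₀ x₀ hK hbd hm0 hreg ht₀ hKu hue hΛ
  have hK2 : 0 < K ^ 2 := by positivity
  have hm4 : 1 / 4 ≤ m := by
    have h : 0 ≤ 2 * m ^ 3 / K ^ 2 := by positivity
    linarith
  -- the extremal element in the route's inline class
  obtain ⟨h1, h2, h3, h4⟩ := isTypeIAncientMild_iff.1 hKu
  have h3' : ∀ s t : ℝ, s < t → t < 0 → ∀ x, u t x = Literature.Analysis.FluidPDE.heatFlow (u s) (t-s) x - ∫ τ in Set.Ioo s t, ∫ y, ((-(inner ℝ (x-y) (u τ y) / (2*(t-τ)) * Literature.Analysis.UnboundedOperators.heatKernel (t-τ) (x-y))) • u τ y + (∫ σ in Set.Ioi (t-τ), Literature.Analysis.UnboundedOperators.heatKernel σ (x-y) / (4*σ^2)) • (inner ℝ (x-y) (u τ y) • u τ y + inner ℝ (u τ y) (u τ y) • (x-y) + inner ℝ (x-y) (u τ y) • u τ y) - ((∫ σ in Set.Ioi (t-τ), Literature.Analysis.UnboundedOperators.heatKernel σ (x-y) / (8*σ^3)) * (inner ℝ (x-y) (u τ y) * inner ℝ (x-y) (u τ y))) • (x-y))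 := by
    intro s t hst ht x
    rw [h3 s t hst ht x]
    rfl
  have hGE := (le_lerayMiddleStrain_iff ht₀ m).1 hΛ
  have hlt : m < 1 / 8 := hX C m u t₀ x₀ ht₀ ⟨h1, h2, h3', h4, hue⟩ hGE (by
    rintro v' ⟨a1, a2, a3, a4, a5⟩ t ht x
    exact (lerayMiddleStrain_le_iff ht m).1
      (hbd v' (isTypeIAncientMild_of_squeezeClass a1 a2 a3 a4) a5 t ht x).2)
  linarith

end Summit.NavierStokesRegularity.NavierStokesRegularity.Theorems

end
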